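import Mathlib
import Summits.NavierStokesRegularity.NavierStokesRegularity.Theorems.TypeIQuarterGateScarEnvelopeTypeISatelliteTowerNoExactReturn

/-!
# Satellite tower for crux `ScarEnvelopeTypeI` (stmt-NavierStokesRegularity-23843) — ROUND-46 Part E, E14/E16: ε-RIGIDITY, QUALITATIVE — uniform self-similarity DEFECT FLOORS by compactness (E14 over an interval of scales; E16 ★★★ at ONE near-one scale for ALL rooted A–B objects, NO envelope — the stable fixed-factor form of the tree's near-identity DSS rung; E16″ one scale for all objects)

Module (26c) of the landing form v1.1 (plate l.618–752, 755–808, 872–965): `aestronglyMeasurable_parabolicCylinder_of_continuousOn`; E14a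
`pastDss_of_tendsto_defect` (`L³_loc` limits inherit EXACT returns from asymptotically exact returns at one scale); E14 `abTower_selfSimilarityDefect_floor` /
`RootObj.exists_selfSimilarityDefect_floor` (η(M, I, a) > 0 over scales `(a,1)`, scale depending on the object); E15a `hasTypeIDecay_of_tendsto_eLpNorm`
(space–time Type-I envelopes pass to `L³_loc` limits — kept as a tool); E16 ★★★ `abTower_nearOne_defect_floor'` / E16′ `RootObj.nearOne_defect_floor'`
(∃ c₁ = Λ(M,4I) > 1 ∀ c ∈ (1/c₁, 1) ∃ η(M, I, c) > 0: EVERY rooted A–B object at level ≤ I has ‖U_c − U‖_{L³(Q₁)} ≥ η — NO envelope; H4/Z3 `pastDss_factors`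
BY NAME replaces Chae–Wolf); E16″ `abTower_selfSimilarityDefect_floor_fixedScale` (E14 with ONE scale for all objects).  NOT landed: E15/E15′
`abTower_nearOne_defect_floor` / `RootObj.nearOne_defect_floor` (plate l.820–871) — by the memo v1.1 they are E16 with an UNUSED envelope hypothesis
(superseded); they stay in the pub plate.  HONEST: η is INEFFECTIVE (contradiction + compactness); a floor at ONE COARSE scale is exactly (θ′)/(υ) and
stays OPEN; classes possibly empty.

PROVENANCE: declaration texts VERBATIM from the HOME artefact of the instrument seat nsreg-p3 g29 (cell `pub/ns-regularity-ideate`):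
`round-46/partE46.lean` v1.1 (sha16 `acc8c98b977afd9e`; v1.0 9d6dadbf46a44df3 superseded; ONE section `UniqueContinuation` written against the TREE over the landed
census modules `…SatelliteTowerRootRateDefs/…GallerySeqCompact/…Closure/…EnvelopeStability/…HullCells`; memo `round-46/ROUND-46.md` v1.1 d8300660cdb27bc5),
scored PASS TEXT+LEAN ★★ by referee ref3 g28 (`SCORE-p3-ROUND-46-0828.md` a46a6fe11ecb425f, 22:11:20Z); the author cannot write under `Theorems/`
(`perm.theorems-prover-only`); landed by the prover ns-es-p1 g6 as landing hand of record (director-ns DIRECTOR-NS #237 (3)) following the landing form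
ROUND-46.md v1.1 §7 (26a–c) and ref3 F2 («(26b) = E13 only»), split into ≤ 400-line modules, the artefact's `#guard_msgs … #print axioms` certificates not landed.  `--supports stmt-NavierStokesRegularity-23843 --as helper`.

PROVENANCE OF THE INPUTS (ref3 R45-F3): everything here is unconditional ONLY because these Literature-lineage landings are tree theorems (used BY NAME,
not re-derived): Lemarié-Rieusset 2016 Thm 9.12 local space–time analyticity `lemarieRieusset2016_local_analyticity_holds` (through
`Theorems.analyticOnNhd_uncurry_of_oseenMild`, `IsTypeIAncientMild.analyticOnNhd_slice_univ`); KNSS 2009 §4 bounded Oseen-mild uniqueness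
`oseenMild_bounded_unique` (through `Theorems.ScenarioCensus.FixedAxis.eq_slice_of_eq_slice`); Tsai 1998 Thm 1 (`IsLerayProfile.exists_eq_const_of_bounded`) +
Fabes–Jones–Rivière (`classical_of_smooth_isMildNSSolutionOn_holds`) through `Theorems.stub_selfSimilarRigidity`; KNSS scaling covariance
`IsTypeIAncientMild.nsRescale`; for E14/E15 the R43 CKN-compactness + persistence theorem `abTower_seqCompact`; for E15 Chae–Wolf 2017 Thm 1.3 through the
tree's `chaeWolf_threshold_le_pastDss_factor` (ROUND-44 Z7).

IN-TREE PRIOR ART (memo v1.1 §0′ ERRATUM, disclosed): the ε = 0 content of E4/E6/E7/E10–E12 and the compactness MECHANISM of E14–E16 already exist for the A–B class in routes RecurrentProfiles/SqueezeCycle (`stub_rlNearIdentityDSS`, H4 `stub_prScalingStabilizer` = ROUND-44 Z3 `pastDss_factors`, `stub_gkWindowIncrementRemoval` + `gk_orbitNeverRests`, `smallHullRemoval`, …); the round's own content is the IDENTITY-THEOREM LOCALISATION (arbitrarily small windows / an open piece of one slice) and the STABLE fixed-scale form E16.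

HONEST FRAMING: RIGIDITY AT ε = 0 / qualitative ε-rigidity INSTRUMENT theorems about HYPOTHETICAL Type-I zoom limits (Albritton–Barker objects of the
census of crux `TypeIQuarterGate.ScarEnvelopeTypeI`, item 23843; classes possibly empty).  Movement 0 on anything open: item 23843, route TypeIQuarterGate,
crux 1589 `RecurrentLiouville`, (ρ)/(θ′)/(υ) of ROUND-45, the DSS cells (τ), (κ) at coarse ratio, N0 and Navier–Stokes regularity are all OPEN — NS
regularity is NOT proved here.  No decl of this round is an edge or a proof-of-item (plate audit: orphan 39 / closes 0); η in E14/E15 is INEFFECTIVE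
(compactness + contradiction).  Nearest print (memo §6): Masuda 1967 / LR2016 Thm 9.12 (E2), Chae 2007 Cor 1.3 / Thm 1.5 (E6/E7), Chae 2015 Thm 1.2 and
Chae–Wolf 2017 Thms 1.3/1.5 (E14/E15) — KNOWN mechanisms, disclosed; the content is the junction with the 23843 census.
-/

noncomputable section

-- the summit-side namespace repeats a component by design (single-conjunct summit, D-0017)
set_option linter.dupNamespace false

open MeasureTheory Set Metric Filter Topology Function
open scoped ENNReal NNReal
open Literature.Analysis.FluidPDE

namespace Summit.NavierStokesRegularity.NavierStokesRegularity.Cruxes.ScarEnvelopeTypeI.ZoomDictionary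

section UniqueContinuation

variable {U W : ℝ → (EuclideanSpace ℝ (Fin 3)) → (EuclideanSpace ℝ (Fin 3))}
  {P : ℝ → (EuclideanSpace ℝ (Fin 3)) → ℝ}
  {H : ℝ → (EuclideanSpace ℝ (Fin 3)) → (EuclideanSpace ℝ (Fin 3)) →L[ℝ] (EuclideanSpace ℝ (Fin 3))}
  {M M' : ℝ}

/-! ### E14. ε-RIGIDITY, QUALITATIVE: defect floors by compactness -/

/-- Class members are a.e.-strongly measurable on every backward cylinder `Q_R(0,0)` (continuity on the slab). -/
theorem aestronglyMeasurable_parabolicCylinder_of_continuousOn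
    {V : ℝ → (EuclideanSpace ℝ (Fin 3)) → (EuclideanSpace ℝ (Fin 3))}
    (hV : ContinuousOn (uncurry V) (Iio (0 : ℝ) ×ˢ (univ : Set (EuclideanSpace ℝ (Fin 3))))) (R : ℝ) :
    AEStronglyMeasurable (uncurry V)
      (volume.restrict (parabolicCylinder R (0 : ℝ × (EuclideanSpace ℝ (Fin 3))))) := by
  have hQs : parabolicCylinder R (0 : ℝ × (EuclideanSpace ℝ (Fin 3))) ⊆
      Iio (0 : ℝ) ×ˢ (univ : Set (EuclideanSpace ℝ (Fin 3))) := by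
    intro z hz
    rw [mem_parabolicCylinder] at hz
    exact mem_prod.2 ⟨by simpa using hz.1.2, mem_univ _⟩
  exact (hV.mono hQs).aestronglyMeasurable (isOpen_parabolicCylinder _ _).measurableSet

/-- ★★ **E14a. `L³_loc` LIMITS INHERIT EXACT RETURNS FROM ASYMPTOTICALLY EXACT RETURNS.**  If continuous-on-the-slab
fields `U_j` converge to a Type-I ancient mild field `U'` in `L³(Q_R(0,0))` for every `R > 0`, and their
self-similarity defects at ONE scale `c > 0` on the unit cylinder tend to zero, `‖(U_j)_c − U_j‖_{L³(Q₁)} → 0`, then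
`c` is an EXACT past factor of `U'` (scaling law on backward cylinders + one triangle inequality + «two `L³` limits
agree a.e.» + the identity theorem E3′). -/
theorem pastDss_of_tendsto_defect {M' : ℝ}
    {Us : ℕ → ℝ → (EuclideanSpace ℝ (Fin 3)) → (EuclideanSpace ℝ (Fin 3))}
    {U' : ℝ → (EuclideanSpace ℝ (Fin 3)) → (EuclideanSpace ℝ (Fin 3))}
    (hUs : ∀ k, ContinuousOn (uncurry (Us k)) (Iio (0 : ℝ) ×ˢ (univ : Set (EuclideanSpace ℝ (Fin 3)))))
    (hU' : IsTypeIAncientMild M' U') {c : ℝ} (hc : 0 < c)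
    (hconv : ∀ R : ℝ, 0 < R → Tendsto (fun j => eLpNorm (uncurry (Us j) - uncurry U') 3
      (volume.restrict (parabolicCylinder R (0 : ℝ × (EuclideanSpace ℝ (Fin 3)))))) atTop (𝓝 0))
    (hdef : Tendsto (fun j => eLpNorm (uncurry (nsRescale c (Us j)) - uncurry (Us j)) 3
      (volume.restrict (parabolicCylinder 1 (0 : ℝ × (EuclideanSpace ℝ (Fin 3)))))) atTop (𝓝 0)) :
    ∀ t < 0, ∀ x, nsRescale c U' t x = U' t x := by
  set Q : Set (ℝ × (EuclideanSpace ℝ (Fin 3))) :=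
    parabolicCylinder 1 (0 : ℝ × (EuclideanSpace ℝ (Fin 3))) with hQ
  -- continuity on the slab is scale invariant
  have hcs : ∀ {V : ℝ → (EuclideanSpace ℝ (Fin 3)) → (EuclideanSpace ℝ (Fin 3))},
      ContinuousOn (uncurry V) (Iio (0 : ℝ) ×ˢ (univ : Set (EuclideanSpace ℝ (Fin 3)))) →
      ContinuousOn (uncurry (nsRescale c V)) (Iio (0 : ℝ) ×ˢ (univ : Set (EuclideanSpace ℝ (Fin 3)))) := by
    intro V hV
    have hpath : Continuous fun z : ℝ × (EuclideanSpace ℝ (Fin 3)) =>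
        ((c ^ 2 * z.1, c • z.2) : ℝ × (EuclideanSpace ℝ (Fin 3))) :=
      (continuous_const.mul continuous_fst).prodMk (continuous_snd.const_smul c)
    have hmaps : MapsTo (fun z : ℝ × (EuclideanSpace ℝ (Fin 3)) =>
        ((c ^ 2 * z.1, c • z.2) : ℝ × (EuclideanSpace ℝ (Fin 3))))
        (Iio (0 : ℝ) ×ˢ (univ : Set (EuclideanSpace ℝ (Fin 3))))
        (Iio (0 : ℝ) ×ˢ (univ : Set (EuclideanSpace ℝ (Fin 3)))) := fun z hz =>
      mem_prod.2 ⟨mem_Iio.2 (mul_neg_of_pos_of_neg (by positivity : (0 : ℝ) < c ^ 2) (mem_Iio.1 (mem_prod.1 hz).1)),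
        mem_univ _⟩
    have h := (hV.comp hpath.continuousOn hmaps).const_smul c
    refine h.congr fun z _ => ?_
    simp only [Function.comp_apply, Pi.smul_apply, uncurry, nsRescale_apply]
  have hmU : ∀ j, AEStronglyMeasurable (uncurry (Us j)) (volume.restrict Q) :=
    fun j => aestronglyMeasurable_parabolicCylinder_of_continuousOn (hUs j) 1
  have hmUc : ∀ j, AEStronglyMeasurable (uncurry (nsRescale c (Us j))) (volume.restrict Q) :=
    fun j => aestronglyMeasurable_parabolicCylinder_of_continuousOn (hcs (hUs j)) 1
  have hmU' : AEStronglyMeasurable (uncurry U') (volume.restrict Q) :=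
    aestronglyMeasurable_parabolicCylinder_of_continuousOn hU'.continuousOn_uncurry 1
  have hmU'c : AEStronglyMeasurable (uncurry (nsRescale c U')) (volume.restrict Q) :=
    aestronglyMeasurable_parabolicCylinder_of_continuousOn (hU'.nsRescale hc).continuousOn_uncurry 1
  -- (1) `(U_j)_c → U'_c` in `L³(Q)`: the scaling law maps it to convergence on `Q_c(0,0)`
  have h1 : Tendsto (fun j => eLpNorm (uncurry (nsRescale c (Us j)) - uncurry (nsRescale c U')) 3
      (volume.restrict Q)) atTop (𝓝 0) := by
    have hκ : ‖c‖ₑ * (ENNReal.ofReal (c ^ 2 * c ^ Module.finrank ℝ (EuclideanSpace ℝ (Fin 3)))⁻¹) ^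
        (1 / (3 : ℝ≥0∞)).toReal ≠ ⊤ :=
      ENNReal.mul_ne_top enorm_ne_top
        (ENNReal.rpow_ne_top_of_nonneg ENNReal.toReal_nonneg ENNReal.ofReal_ne_top)
    have h := ENNReal.Tendsto.const_mul (hconv (c * 1) (by positivity)) (Or.inr hκ)
    rw [mul_zero] at h
    refine Tendsto.congr' (Eventually.of_forall fun j => ?_) h
    exact (eLpNorm_nsRescale_sub_nsRescale_parabolicCylinder hc (Us j) U' 3 1).symm
  -- (2) `(U_j)_c → U'` in `L³(Q)`: small defect + convergence, one triangle inequality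
  have h2 : Tendsto (fun j => eLpNorm (uncurry (nsRescale c (Us j)) - uncurry U') 3
      (volume.restrict Q)) atTop (𝓝 0) := by
    have hsum := hdef.add (hconv 1 one_pos)
    rw [add_zero] at hsum
    refine tendsto_of_tendsto_of_tendsto_of_le_of_le tendsto_const_nhds hsum (fun _ => bot_le) fun j => ?_
    have e : uncurry (nsRescale c (Us j)) - uncurry U' =
        (uncurry (nsRescale c (Us j)) - uncurry (Us j)) + (uncurry (Us j) - uncurry U') := by
      abel
    rw [e]
    exact eLpNorm_add_le ((hmUc j).sub (hmU j)) ((hmU j).sub hmU') (by norm_num)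
  -- two `L³(Q)` limits of one sequence agree a.e.; then the identity theorem E3′
  have hae : uncurry (nsRescale c U') =ᵐ[volume.restrict Q] uncurry U' :=
    ae_eq_of_tendsto_eLpNorm_three (f := fun j => uncurry (nsRescale c (Us j))) hmUc hmU'c hmU' h1 h2
  refine pastDss_of_ae_eq_on hU' hc ?_ (hae.mono fun z hz => hz)
  rw [(isOpen_parabolicCylinder _ _).interior_eq]
  refine ⟨((-1 / 2 : ℝ), (0 : EuclideanSpace ℝ (Fin 3))), ?_, mem_prod.2 ⟨by norm_num, mem_univ _⟩⟩
  rw [mem_parabolicCylinder]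
  norm_num

/-- ★★★ **E14. UNIFORM MOMENTARY-SELF-SIMILARITY DEFECT FLOOR (ε-rigidity for E7, qualitative).**
Fix the rate `M`, a bound `I < ⊤` on the scale-invariant quantity `𝐈`, and an interval of scales `(a, 1)`,
`0 < a < 1`.  There is `η = η(M, I, a) > 0` such that EVERY rooted A–B object `(U, P, H)` with `𝐈(U) ≤ I` has SOME
scale `c ∈ (a, 1)` at which its self-similarity defect on the unit backward cylinder is at least `η`:
`‖U_c − U‖_{L³(Q₁(0,0))} ≥ η`.  In words: rooted census objects are UNIFORMLY FAR from momentarily self-similar.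
WHERE NS ENTERS: (i) CKN compactness + persistence of singular points for the A–B class (`abTower_seqCompact`,
R43), (ii) the `L³` scaling law on backward cylinders, (iii) the identity theorem E3′ (LR 2016 Thm 9.12) through
E14a, and (iv) Tsai's Liouville theorem through E6a′.  A violating sequence has a rooted A–B limit all of whose
scales `c ∈ (a, 1)` are exact past factors; E6a′ kills it; a field vanishing on the past is regular at the root. -/
theorem abTower_selfSimilarityDefect_floor (M : ℝ) {I : ℝ≥0∞} (hI : I < ⊤) {a : ℝ} (ha0 : 0 < a) (ha1 : a < 1) :
    ∃ η : ℝ≥0∞, 0 < η ∧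
      ∀ (U : ℝ → (EuclideanSpace ℝ (Fin 3)) → (EuclideanSpace ℝ (Fin 3)))
        (P : ℝ → (EuclideanSpace ℝ (Fin 3)) → ℝ)
        (H : ℝ → (EuclideanSpace ℝ (Fin 3)) → (EuclideanSpace ℝ (Fin 3)) →L[ℝ] (EuclideanSpace ℝ (Fin 3))),
        ABTower M U P H → ¬ RegPt U 0 →
          typeIBound (Iio (0 : ℝ) ×ˢ (univ : Set (EuclideanSpace ℝ (Fin 3)))) U P H ≤ I →
          ∃ c ∈ Ioo a 1, η ≤ eLpNorm (uncurry (nsRescale c U) - uncurry U) 3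
            (volume.restrict (parabolicCylinder 1 (0 : ℝ × (EuclideanSpace ℝ (Fin 3))))) := by
  by_contra hcon
  push Not at hcon
  have hpos : ∀ k : ℕ, (0 : ℝ≥0∞) < (((k + 1 : ℕ) : ℝ≥0∞))⁻¹ :=
    fun k => ENNReal.inv_pos.2 (ENNReal.natCast_ne_top _)
  choose Us Ps Hs hAB hroot hIk hsmall using fun k : ℕ => hcon _ (hpos k)
  obtain ⟨U', P', H', σ, hσ, hAB', -, -, hconv, hpers⟩ := abTower_seqCompact hI Us Ps Hs hAB hIk
  -- the limit is rooted (persistence of singular points)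
  have hroot' : ¬ RegPt U' 0 := hpers 0 (Frequently.of_forall fun j => hroot (σ j))
  have hη : Tendsto (fun j => (((σ j + 1 : ℕ) : ℝ≥0∞))⁻¹) atTop (𝓝 0) :=
    ENNReal.tendsto_inv_nat_nhds_zero.comp ((tendsto_add_atTop_nat 1).comp hσ.tendsto_atTop)
  -- the limit is exactly past-DSS with every factor in `(a, 1)` (E14a)
  have hpast : ∀ c ∈ Ioo a 1, ∀ t < 0, ∀ x, nsRescale c U' t x = U' t x := fun c hc =>
    pastDss_of_tendsto_defect (fun j => (hAB (σ j)).1.continuousOn_uncurry) hAB'.1 (ha0.trans hc.1) hconv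
      (tendsto_of_tendsto_of_tendsto_of_le_of_le tendsto_const_nhds hη (fun _ => bot_le)
        fun j => (hsmall (σ j) c hc).le)
  -- E6a′ kills the limit; a field vanishing on the past is regular at the root: contradiction
  exact hroot' (regPt_zero_of_eq_zero_past (eq_zero_of_pastDss_interval hAB'.1 ha0 ha1 hpast))

/-- ★★★ **E14′. Census reading (TNode form).**  Uniformly over rooted A–B objects `n` with `𝐈(n) ≤ I < ⊤`: some
scale `c ∈ (a, 1)` has `‖(n.U)_c − n.U‖_{L³(Q₁)} ≥ η(M, I, a) > 0` — the ε > 0 companion of E7. -/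
theorem RootObj.exists_selfSimilarityDefect_floor (M : ℝ) {I : ℝ≥0∞} (hI : I < ⊤) {a : ℝ} (ha0 : 0 < a)
    (ha1 : a < 1) :
    ∃ η : ℝ≥0∞, 0 < η ∧ ∀ n : TNode, RootObj M n →
      typeIBound (Iio (0 : ℝ) ×ˢ (univ : Set (EuclideanSpace ℝ (Fin 3)))) n.U n.P n.H ≤ I →
        ∃ c ∈ Ioo a 1, η ≤ eLpNorm (uncurry (nsRescale c n.U) - uncurry n.U) 3
          (volume.restrict (parabolicCylinder 1 (0 : ℝ × (EuclideanSpace ℝ (Fin 3))))) := by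
  obtain ⟨η, hη, h⟩ := abTower_selfSimilarityDefect_floor M hI ha0 ha1
  exact ⟨η, hη, fun n hn hIn => h n.U n.P n.H hn.1 hn.2 hIn⟩

/-- **E15a. Space–time envelopes pass to `L³_loc` limits.**  If fields `U_j`, continuous on the slab and enveloped
with constant `A` (`‖U_j(t,x)‖ ≤ A/(‖x‖ + √(−t))`), converge in every `L³(Q_R(0,0))` to a Type-I ancient mild `U'`,
then `U'` is enveloped with the same constant (a.e. along an a.e.-convergent subsequence, then everywhere by
continuity: `norm_le_of_ae_le_of_continuousOn`). -/
theorem hasTypeIDecay_of_tendsto_eLpNorm {A M' : ℝ}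
    {Us : ℕ → ℝ → (EuclideanSpace ℝ (Fin 3)) → (EuclideanSpace ℝ (Fin 3))}
    {U' : ℝ → (EuclideanSpace ℝ (Fin 3)) → (EuclideanSpace ℝ (Fin 3))}
    (hUs : ∀ k, ContinuousOn (uncurry (Us k)) (Iio (0 : ℝ) ×ˢ (univ : Set (EuclideanSpace ℝ (Fin 3)))))
    (hdec : ∀ k, HasTypeIDecay A (Us k)) (hU' : IsTypeIAncientMild M' U')
    (hconv : ∀ R : ℝ, 0 < R → Tendsto (fun j => eLpNorm (uncurry (Us j) - uncurry U') 3
      (volume.restrict (parabolicCylinder R (0 : ℝ × (EuclideanSpace ℝ (Fin 3)))))) atTop (𝓝 0)) :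
    HasTypeIDecay A U' := by
  intro t ht x
  set R : ℝ := ‖x‖ + Real.sqrt (-t) + 1 with hR
  have hR0 : 0 < R := by positivity
  have hQs : parabolicCylinder R (0 : ℝ × (EuclideanSpace ℝ (Fin 3))) ⊆
      Iio (0 : ℝ) ×ˢ (univ : Set (EuclideanSpace ℝ (Fin 3))) := by
    intro z hz
    rw [mem_parabolicCylinder] at hz
    exact mem_prod.2 ⟨by simpa using hz.1.2, mem_univ _⟩
  have hzQ : ((t, x) : ℝ × (EuclideanSpace ℝ (Fin 3))) ∈
      parabolicCylinder R (0 : ℝ × (EuclideanSpace ℝ (Fin 3))) := by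
    rw [mem_parabolicCylinder]
    have hs0 : 0 ≤ Real.sqrt (-t) := Real.sqrt_nonneg _
    have hs2 : Real.sqrt (-t) ^ 2 = -t := Real.sq_sqrt (neg_nonneg.2 ht.le)
    have hx0 : 0 ≤ ‖x‖ := norm_nonneg x
    refine ⟨⟨?_, by simpa using ht⟩, ?_⟩
    · have h1 : Real.sqrt (-t) < R := by rw [hR]; linarith
      have h2 : -t < R ^ 2 := by nlinarith
      simp only [Prod.fst_zero]
      linarith
    · simp only [Prod.snd_zero, dist_zero_right]
      rw [hR]
      linarith
  -- a.e. convergence along a subsequence on `Q_R`, and the a.e. bound for the limit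
  obtain ⟨φ, -, hae⟩ := exists_subseq_tendsto_ae₃
    (fun k => aestronglyMeasurable_parabolicCylinder_of_continuousOn (hUs k) R)
    (aestronglyMeasurable_parabolicCylinder_of_continuousOn hU'.continuousOn_uncurry R) (hconv R hR0)
  have hbound : ∀ᵐ w ∂(volume.restrict (parabolicCylinder R (0 : ℝ × (EuclideanSpace ℝ (Fin 3))))),
      ‖uncurry U' w‖ ≤ A / (‖w.2‖ + Real.sqrt (-w.1)) := by
    filter_upwards [hae, ae_restrict_mem (isOpen_parabolicCylinder _ _).measurableSet] with w hw hwQ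
    have hw1 : w.1 < 0 := by simpa using (mem_parabolicCylinder.1 hwQ).1.2
    exact le_of_tendsto' hw.norm fun i => hdec (φ i) w.1 hw1 w.2
  -- pointwise, by continuity of both sides on the open cylinder
  have hg : ContinuousOn (fun w : ℝ × (EuclideanSpace ℝ (Fin 3)) => A / (‖w.2‖ + Real.sqrt (-w.1)))
      (parabolicCylinder R (0 : ℝ × (EuclideanSpace ℝ (Fin 3)))) := by
    refine continuousOn_const.div
      ((continuous_norm.comp continuous_snd).add
        (Real.continuous_sqrt.comp (continuous_neg.comp continuous_fst))).continuousOn fun w hw => ?_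
    have hw1 : w.1 < 0 := by simpa using (mem_parabolicCylinder.1 hw).1.2
    exact (add_pos_of_nonneg_of_pos (norm_nonneg _) (Real.sqrt_pos.2 (neg_pos.2 hw1))).ne'
  have key := norm_le_of_ae_le_of_continuousOn (isOpen_parabolicCylinder R _)
    (hU'.continuousOn_uncurry.mono hQs) hg hbound (t, x) hzQ
  simpa using key

/-- ★★★ **E16 (ADDENDUM v1.1). NEAR-ONE SINGLE-SCALE DEFECT FLOOR — NO ENVELOPE.**  For every `M`, every level
`I < ⊤` there is `c₁ = Λ(M, 4I) > 1` — the H4 constant of the TREE (`pastDss_factors`, R44 Z3 = crux-1589's landed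
`stub_prScalingStabilizer` / near-identity DSS rung `stub_rlNearIdentityDSS`, compactness + Tsai, NO envelope) — such
that for EVERY SINGLE scale `c ∈ (1/c₁, 1)` there is `η = η(M, I, c) > 0` with `‖U_c − U‖_{L³(Q₁(0,0))} ≥ η` for every
rooted A–B object at level `𝐈 ≤ I`.  I.e. the tree's near-identity DSS rung is OPEN AT EACH FIXED FACTOR: η-near-exact
returns at one near-one scale are excluded uniformly over the class.  SUPERSEDES E15 (the envelope is not needed; the
threshold is H4's `Λ(M,4I)` instead of Chae–Wolf's `λ₁(A)`) and E14 (the scale can be FIXED near one).  Proof: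
contradiction + `abTower_seqCompact` (limit at level `≤ 4I`, singular root persists) + E14a (the limit returns
EXACTLY at scale `c`) + `pastDss_inv` (factor `1/c ∈ (1, Λ)`) + Z3 (the limit is DSS-free — absurd — or has least
factor `λ₀ ≥ Λ` and all factors `λ₀^k`, so `1/c = λ₀^k` with `k ≥ 1`, `1/c ≥ λ₀ ≥ Λ` — absurd).  DISCLOSURE: the ε = 0
content is the tree's (crux 1589 lineage); only the STABLE (ε > 0, fixed-scale) form is claimed; η is ineffective. -/
theorem abTower_nearOne_defect_floor' (M : ℝ) {I : ℝ≥0∞} (hI : I < ⊤) :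
    ∃ c₁ : ℝ, 1 < c₁ ∧ ∀ c : ℝ, c₁⁻¹ < c → c < 1 →
      ∃ η : ℝ≥0∞, 0 < η ∧
        ∀ (U : ℝ → (EuclideanSpace ℝ (Fin 3)) → (EuclideanSpace ℝ (Fin 3)))
          (P : ℝ → (EuclideanSpace ℝ (Fin 3)) → ℝ)
          (H : ℝ → (EuclideanSpace ℝ (Fin 3)) → (EuclideanSpace ℝ (Fin 3)) →L[ℝ] (EuclideanSpace ℝ (Fin 3))),
          ABTower M U P H → ¬ RegPt U 0 →
            typeIBound (Iio (0 : ℝ) ×ˢ (univ : Set (EuclideanSpace ℝ (Fin 3)))) U P H ≤ I →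
            η ≤ eLpNorm (uncurry (nsRescale c U) - uncurry U) 3
              (volume.restrict (parabolicCylinder 1 (0 : ℝ × (EuclideanSpace ℝ (Fin 3))))) := by
  have h4I : (4 : ℝ≥0∞) * I < ⊤ := ENNReal.mul_lt_top (by simp) hI
  obtain ⟨c₁, hc₁, hZ3⟩ := pastDss_factors M (4 * I) h4I
  refine ⟨c₁, hc₁, fun c hcl hcu => ?_⟩
  have hc0 : 0 < c := (inv_pos.2 (zero_lt_one.trans hc₁)).trans hcl
  by_contra hcon
  push Not at hcon
  have hpos : ∀ k : ℕ, (0 : ℝ≥0∞) < (((k + 1 : ℕ) : ℝ≥0∞))⁻¹ :=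
    fun k => ENNReal.inv_pos.2 (ENNReal.natCast_ne_top _)
  choose Us Ps Hs hAB hroot hIk hsmall using fun k : ℕ => hcon _ (hpos k)
  obtain ⟨U', P', H', σ, hσ, hAB', hI', -, hconv, hpers⟩ := abTower_seqCompact hI Us Ps Hs hAB hIk
  have hroot' : ¬ RegPt U' 0 := hpers 0 (Frequently.of_forall fun j => hroot (σ j))
  have hη : Tendsto (fun j => (((σ j + 1 : ℕ) : ℝ≥0∞))⁻¹) atTop (𝓝 0) :=
    ENNReal.tendsto_inv_nat_nhds_zero.comp ((tendsto_add_atTop_nat 1).comp hσ.tendsto_atTop)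
  -- the limit returns EXACTLY at scale `c` (E14a)
  have hpast : ∀ t < 0, ∀ x, nsRescale c U' t x = U' t x :=
    pastDss_of_tendsto_defect (fun j => (hAB (σ j)).1.continuousOn_uncurry) hAB'.1 hc0 hconv
      (tendsto_of_tendsto_of_tendsto_of_le_of_le tendsto_const_nhds hη (fun _ => bot_le)
        fun j => (hsmall (σ j)).le)
  -- hence exactly past-DSS with factor `1/c ∈ (1, Λ)`: excluded by the tree's least-factor theorem Z3/H4
  have hinv := pastDss_inv hc0 hpast
  have h1c : 1 < c⁻¹ := (one_lt_inv₀ hc0).2 hcu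
  have hlt : c⁻¹ < c₁ := by
    have h := inv_strictAnti₀ (inv_pos.2 (zero_lt_one.trans hc₁)) hcl
    rwa [inv_inv] at h
  rcases hZ3 U' P' H' hAB' hroot' hI' with hfree | ⟨lam0, hlam0, -, hiff⟩
  · exact absurd (hfree c⁻¹ (inv_pos.2 hc0) hinv) h1c.ne'
  · obtain ⟨k, hk⟩ := (hiff c⁻¹ (inv_pos.2 hc0)).1 hinv
    have hlam1 : 1 < lam0 := lt_of_lt_of_le hc₁ hlam0
    have hk1 : 1 ≤ k := by
      have : 0 < k := (one_lt_zpow_iff_right₀ hlam1).1 (hk ▸ h1c)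
      omega
    have : lam0 ≤ c⁻¹ := by
      rw [hk]
      calc lam0 = lam0 ^ (1 : ℤ) := (zpow_one lam0).symm
        _ ≤ lam0 ^ k := zpow_le_zpow_right₀ hlam1.le hk1
    exact absurd (hlam0.trans this) (not_le.2 hlt)

/-- ★★★ **E16′. Census reading (TNode form)** of E16: at each fixed near-one scale `c ∈ (1/Λ(M,4I), 1)`, rooted A–B
objects with `𝐈 ≤ I` keep a uniform positive `L³(Q₁)`-distance from their own rescaling `U_c` (no envelope). -/
theorem RootObj.nearOne_defect_floor' (M : ℝ) {I : ℝ≥0∞} (hI : I < ⊤) :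
    ∃ c₁ : ℝ, 1 < c₁ ∧ ∀ c : ℝ, c₁⁻¹ < c → c < 1 →
      ∃ η : ℝ≥0∞, 0 < η ∧ ∀ n : TNode, RootObj M n →
        typeIBound (Iio (0 : ℝ) ×ˢ (univ : Set (EuclideanSpace ℝ (Fin 3)))) n.U n.P n.H ≤ I →
          η ≤ eLpNorm (uncurry (nsRescale c n.U) - uncurry n.U) 3
            (volume.restrict (parabolicCylinder 1 (0 : ℝ × (EuclideanSpace ℝ (Fin 3))))) := by
  obtain ⟨c₁, hc₁, h⟩ := abTower_nearOne_defect_floor' M hI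
  refine ⟨c₁, hc₁, fun c hcl hcu => ?_⟩
  obtain ⟨η, hη, h'⟩ := h c hcl hcu
  exact ⟨η, hη, fun n hn hIn => h' n.U n.P n.H hn.1 hn.2 hIn⟩

/-- **E16″. E14 WITH A FIXED SCALE** (corollary of E16): for every interval of scales `(a, 1)` there is ONE scale
`c ∈ (a, 1)` — the same for all objects — and `η > 0` with `‖U_c − U‖_{L³(Q₁)} ≥ η` for every rooted A–B object at
level `≤ I`.  (E14 let the scale depend on the object.) -/
theorem abTower_selfSimilarityDefect_floor_fixedScale (M : ℝ) {I : ℝ≥0∞} (hI : I < ⊤) {a : ℝ} (ha1 : a < 1) :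
    ∃ c ∈ Ioo a 1, ∃ η : ℝ≥0∞, 0 < η ∧
      ∀ (U : ℝ → (EuclideanSpace ℝ (Fin 3)) → (EuclideanSpace ℝ (Fin 3)))
        (P : ℝ → (EuclideanSpace ℝ (Fin 3)) → ℝ)
        (H : ℝ → (EuclideanSpace ℝ (Fin 3)) → (EuclideanSpace ℝ (Fin 3)) →L[ℝ] (EuclideanSpace ℝ (Fin 3))),
        ABTower M U P H → ¬ RegPt U 0 →
          typeIBound (Iio (0 : ℝ) ×ˢ (univ : Set (EuclideanSpace ℝ (Fin 3)))) U P H ≤ I →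
          η ≤ eLpNorm (uncurry (nsRescale c U) - uncurry U) 3
            (volume.restrict (parabolicCylinder 1 (0 : ℝ × (EuclideanSpace ℝ (Fin 3))))) := by
  obtain ⟨c₁, hc₁, h⟩ := abTower_nearOne_defect_floor' M hI
  have hc₁0 : 0 < c₁⁻¹ := inv_pos.2 (zero_lt_one.trans hc₁)
  have hc₁1 : c₁⁻¹ < 1 := inv_lt_one_of_one_lt₀ hc₁
  set c : ℝ := (max a c₁⁻¹ + 1) / 2 with hc_def
  have hlo : max a c₁⁻¹ < c := by
    rw [hc_def]; have := max_lt ha1 hc₁1; linarith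
  have hcu : c < 1 := by
    rw [hc_def]; have := max_lt ha1 hc₁1; linarith
  obtain ⟨η, hη, h'⟩ := h c ((le_max_right _ _).trans_lt hlo) hcu
  exact ⟨c, ⟨(le_max_left _ _).trans_lt hlo, hcu⟩, η, hη, h'⟩

end UniqueContinuation

end Summit.NavierStokesRegularity.NavierStokesRegularity.Cruxes.ScarEnvelopeTypeI.ZoomDictionary

end
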